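import Summits.BirchSwinnertonDyer.BirchSwinnertonDyer.Theses.PrintX9
import Summits.BirchSwinnertonDyer.BirchSwinnertonDyer.Theorems.PrintX9HowardContainmentPinnedOfFlachLeafIntended
import Summits.BirchSwinnertonDyer.BirchSwinnertonDyer.Theorems.HowardFlachSkewPairingAtLevelIntendedHolds
import HarnessLib

/-!
# Skeleton «print_leaves» for the crux A^pin `HowardContainmentLightFramePinned` (stmt-BirchSwinnertonDyer-26356, PrintX9 r203)

Line-writer skeleton v2 (linewriter-bsd-display13-1 g0, 2026-08-31; v1 e2f514c233aa4a6d named FIVE leaves through the older nine-binder door 23238 — superseded: Howard Thm. 1.6.1, Mastella–Zerman and CGLS non-vanishing are kernel-discharged on the light frames). COMPOSITION / PRINT LINE — NOT leaf progress, NOT research.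
BSD is not proved by this.

THE LINE. A^pin = Howard's Λ-adic Heegner containment `I(ℋ_F)² ≤ char(X_tors)` for the frame's OWN pinned family
(`¬ (p:ℤ) ∣ Dt.c`, tie `F.Dt = Dt`) on every rank-one LIGHT X9 Heegner frame (ClassX9; odd d_K ≠ −3, 5 ≤ p),
ANY class number. The route's A-side door is `HowardContainmentLightFramePinnedOfFlachLeavesIntended`
(h141″ → F-411 → CGS 6.5.2 → A^pin), closed by
`Theorems.PrintX9OfFlachLeafIntended.howardContainmentLightFramePinned_of_prop141Intended_kolyvaginSystem_cgs` (p723343),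
and its Howard binder h141″ = `HowardFlachSkewPairingAtLevelIntended` (item 24808) is itself a KERNEL THEOREM
(`Theorems.HowardFlachSkewPairingIntended.prop141_casselsTate_skewPairing_atLevel_printIntended_holds`: Flach's pairing on Howard's
level tower, fed with the tree's Čebotarev and Poitou–Tate theorems). Hence the print debt of A^pin is EXACTLY TWO cite-only leaves,
which this skeleton names as its two stubs (route decls BY NAME = registered obligations 23236 · 27112):
* `stub_cglsHeegnerKolyvaginSystem` — CGLS 2022 Thm. 4.1.1 in Kolyvagin-system form, κ₁ ≠ 0 (F-411, item 23236). PRINT.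
* `stub_cgsHowardDivisibilityPLocalized` — CGS 2025 Thm. 6.5.2, Howard divisibility over Λ[1/p] (item 27112). PRINT.
`HowardContainmentLightFramePinned_of` is the kernel composition (no sorry outside the stubs). No Mastella–Zerman, no CGLS
non-vanishing, no tower / Coates–Greenberg binder, no class-number split (all kernel-discharged on the light frames: p685979,
p687364, p690035, p681749, and h141″ by p-HowardFlachSkewPairingAtLevelIntendedHolds).
Honesty: both stubs are printed theorems entered as named facts (formalization work, (685)(c)); as MATHEMATICS nothing here is open.
-/

set_option autoImplicit false
set_option linter.dupNamespace false

noncomputable section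

namespace Summit.BirchSwinnertonDyer.BirchSwinnertonDyer.Cruxes.HowardContainmentLightFramePinned.PrintLeaves

/-- Stub F-411 (PRINT, by name = route item 23236): CGLS 2022 Thm. 4.1.1 — the Λ-adic Heegner classes form a Kolyvagin system with
κ₁ ≠ 0. [cite: CastellaGrossiLeeSkinner2022, Thm. 4.1.1, Rem. 4.1.4] -/
theorem stub_cglsHeegnerKolyvaginSystem :
    Summit.BirchSwinnertonDyer.BirchSwinnertonDyer.Theses.PrintX9.CGLSHeegnerKolyvaginSystem := by
  sorry

/-- Stub CGS 6.5.2 (PRINT, by name = route item 27112): Castella–Grossi–Skinner 2025 Thm. 6.5.2 — Howard's divisibility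
`char(X_tors) ∣ I(ℋ)²` over Λ[1/p], any class number. [cite: CastellaGrossiSkinner2025, Thm. 6.5.2] -/
theorem stub_cgsHowardDivisibilityPLocalized :
    Summit.BirchSwinnertonDyer.BirchSwinnertonDyer.Theses.PrintX9.CGSHowardDivisibilityPLocalized := by
  sorry

/-- **Composition (kernel; the two print stubs used BY NAME): A^pin** — the closed Flach-leaf door (p723343) with its Howard
binder h141″ discharged by the kernel theorem `prop141_casselsTate_skewPairing_atLevel_printIntended_holds`. -/
theorem HowardContainmentLightFramePinned_of :
    Summit.BirchSwinnertonDyer.BirchSwinnertonDyer.Theses.PrintX9.HowardContainmentLightFramePinned :=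
  Summit.BirchSwinnertonDyer.BirchSwinnertonDyer.Theorems.PrintX9OfFlachLeafIntended.howardContainmentLightFramePinned_of_prop141Intended_kolyvaginSystem_cgs
    Summit.BirchSwinnertonDyer.BirchSwinnertonDyer.Theorems.HowardFlachSkewPairingIntended.prop141_casselsTate_skewPairing_atLevel_printIntended_holds
    stub_cglsHeegnerKolyvaginSystem stub_cgsHowardDivisibilityPLocalized

end Summit.BirchSwinnertonDyer.BirchSwinnertonDyer.Cruxes.HowardContainmentLightFramePinned.PrintLeaves

end
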